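import Mathlib
import HarnessLib

/-!
# From window concentration to a first-moment floor (stub S2, card F1)

Abstract measure theory consumed by `WindowExtinction_of` (line `Sketch`, crux idea
`wall-conditioned-cell-spread`).  Let `w ≥ 0` be an integrable weight on a measure space `(Ω, μ)`
with total mass `Z = ∫ w ∂μ` (on the lattice: the phase-quenched `∏ |det|` weight), and let
`X : Ω → ℤ` be a measurable integer observable (the spectral index) with `|X| · w` integrable.
If for ONE interval count `J` every window `{x ≤ X < x + J d}` carries `w`-mass at most
`(δ + J κ) · Z`, then `((J d / 2 − 1) · (1 − δ − J κ)) · Z ≤ ∫ |X| w ∂μ`.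

Proof.  If `J d / 2 − 1 ≤ 0` the left side is `≤ 0 ≤ ∫ |X| w`.  Otherwise put `h = ⌊J d / 2⌋`
and take the single window `W = {−h ≤ X < −h + J d}`; off `W` either `X ≤ −h − 1` or
`X ≥ J d − h ≥ J d / 2`, so `|X| ≥ J d / 2 − 1` on `Wᶜ`, whence
`∫ |X| w ≥ ∫_{Wᶜ} |X| w ≥ (J d / 2 − 1) ∫_{Wᶜ} w = (J d / 2 − 1) (Z − ∫_W w)
  ≥ (J d / 2 − 1) (1 − δ − J κ) Z`
(`MeasureTheory.integral_add_compl`, `MeasureTheory.setIntegral_mono_on`).  Nothing lattice-specific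
is here; the hypotheses `0 < d`, `0 ≤ κ`, `0 ≤ δ` are part of the registered signature and are not
used by the proof.
-/

noncomputable section

namespace Summit.QuantumFields.QCD.Cruxes.WindowExtinction.WallConditionedCellSpread

open MeasureTheory

/-- **S2 — from window concentration to a first-moment floor (card F1 as a theorem).**
If a weight `w ≥ 0` and an integer observable `X` on a measure space satisfy, for ONE interval
count `J`, `∫_{X ∈ [x, x + J d)} w ≤ (δ + J κ) · ∫ w` for every `x`, then
`((J d/2 − 1) · (1 − δ − J κ)) · ∫ w ≤ ∫ |X| w` (take `x = −⌊J d/2⌋`; off that interval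
`|X| ≥ J d/2 − 1`). -/
theorem stub_windowToMoment :
    ∀ {Ω : Type*} [MeasurableSpace Ω] (μ : Measure Ω) (w : Ω → ℝ) (X : Ω → ℤ) (d J : ℕ) (κ δ : ℝ),
      0 < d → 0 ≤ κ → 0 ≤ δ → δ + J * κ ≤ 1 → (∀ ω, 0 ≤ w ω) → Measurable X → Integrable w μ →
      Integrable (fun ω => |(X ω : ℝ)| * w ω) μ →
      (∀ x : ℤ, ∫ ω in {ω | x ≤ X ω ∧ X ω < x + J * d}, w ω ∂μ ≤ (δ + J * κ) * ∫ ω, w ω ∂μ) →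
      ((J * d : ℝ) / 2 - 1) * (1 - δ - J * κ) * (∫ ω, w ω ∂μ) ≤ ∫ ω, |(X ω : ℝ)| * w ω ∂μ := by
  intro Ω _ μ w X d J κ δ _hd _hκ _hδ hsum hw0 hX hwint hXwint hwin
  have hZ0 : 0 ≤ ∫ ω, w ω ∂μ := integral_nonneg hw0
  have hI0 : 0 ≤ ∫ ω, |(X ω : ℝ)| * w ω ∂μ :=
    integral_nonneg fun ω => mul_nonneg (abs_nonneg _) (hw0 ω)
  have hB : 0 ≤ 1 - δ - (J : ℝ) * κ := by linarith
  by_cases hA : (J * d : ℝ) / 2 - 1 ≤ 0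
  · linarith [mul_nonneg (mul_nonneg (neg_nonneg.mpr hA) hB) hZ0]
  rw [not_le] at hA
  -- the centred window `W = {−h ≤ X < −h + J d}`, `h = ⌊J d / 2⌋`
  obtain ⟨h, h2⟩ : ∃ h : ℕ, 2 * h ≤ J * d ∧ J * d < 2 * h + 2 :=
    ⟨J * d / 2, by omega, by omega⟩
  have h2R : (2 * h : ℝ) ≤ J * d ∧ (J * d : ℝ) < 2 * h + 2 := by exact_mod_cast h2
  set W : Set Ω := X ⁻¹' Set.Ico (-(h : ℤ)) (-(h : ℤ) + J * d) with hW
  have hWm : MeasurableSet W := hX MeasurableSet.of_discrete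
  have hwinx : ∫ ω in W, w ω ∂μ ≤ (δ + J * κ) * ∫ ω, w ω ∂μ := hwin (-(h : ℤ))
  -- off `W` the observable is large: `|X| ≥ J d / 2 − 1`
  have hoff : ∀ ω ∈ Wᶜ, (J * d : ℝ) / 2 - 1 ≤ |(X ω : ℝ)| := by
    intro ω hω
    simp only [hW, Set.mem_compl_iff, Set.mem_preimage, Set.mem_Ico, not_and_or, not_le,
      not_lt] at hω
    have hle := le_abs_self (X ω : ℝ)
    have hge := neg_le_abs (X ω : ℝ)
    rcases hω with hlt | hbig
    · have h1 : X ω + 1 ≤ -(h : ℤ) := by omega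
      have h1R : (X ω : ℝ) + 1 ≤ -(h : ℝ) := by exact_mod_cast h1
      linarith
    · have h1R : ((-(h : ℤ) + J * d : ℤ) : ℝ) ≤ (X ω : ℝ) := Int.cast_le.mpr hbig
      push_cast at h1R
      linarith
  -- integrate: `∫ |X| w ≥ ∫_{Wᶜ} |X| w ≥ (J d/2 − 1) ∫_{Wᶜ} w = (J d/2 − 1)(Z − ∫_W w)`
  have hsplit := integral_add_compl hWm hXwint
  have hsplitw := integral_add_compl hWm hwint
  have hWnn : 0 ≤ ∫ ω in W, |(X ω : ℝ)| * w ω ∂μ :=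
    setIntegral_nonneg hWm fun ω _ => mul_nonneg (abs_nonneg _) (hw0 ω)
  have hcomp :
      ((J * d : ℝ) / 2 - 1) * ∫ ω in Wᶜ, w ω ∂μ ≤ ∫ ω in Wᶜ, |(X ω : ℝ)| * w ω ∂μ := by
    rw [← integral_const_mul]
    refine setIntegral_mono_on (hwint.const_mul _).integrableOn hXwint.integrableOn hWm.compl ?_
    intro ω hω
    exact mul_le_mul_of_nonneg_right (hoff ω hω) (hw0 ω)
  calc ((J * d : ℝ) / 2 - 1) * (1 - δ - J * κ) * ∫ ω, w ω ∂μ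
      = ((J * d : ℝ) / 2 - 1) * (∫ ω, w ω ∂μ - (δ + J * κ) * ∫ ω, w ω ∂μ) := by ring
    _ ≤ ((J * d : ℝ) / 2 - 1) * (∫ ω, w ω ∂μ - ∫ ω in W, w ω ∂μ) :=
        mul_le_mul_of_nonneg_left (by linarith) hA.le
    _ = ((J * d : ℝ) / 2 - 1) * ∫ ω in Wᶜ, w ω ∂μ := by rw [← hsplitw]; ring
    _ ≤ ∫ ω in Wᶜ, |(X ω : ℝ)| * w ω ∂μ := hcomp
    _ ≤ ∫ ω, |(X ω : ℝ)| * w ω ∂μ := by rw [← hsplit]; linarith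

end Summit.QuantumFields.QCD.Cruxes.WindowExtinction.WallConditionedCellSpread

end
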